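import Summits.HubbardSuperconductivity.HubbardSuperconductivity.Theses.JosephsonMirror
import HarnessLib

/-!
# Crux `JmPairBridge` (stmt-HubbardSuperconductivity-2226), line `Sketch` (Schur landing):
# stub `stub_schurGlue` — the route glue with simplicity replaced by irreducibility

Route `JosephsonMirror`. The route's proved glue `JmCruxGlue : JmInterchange → JmCusp → JmPairBridge`
(`Theorems/JosephsonMirrorGlue`) uses `JmCusp (ii)`, eventual SIMPLICITY of the `(N_L, 0)` ground floor, to
turn the mirror's SOME-pair bridge into the EVERY-ground-state bridge X. This file is the Schur form:
`JmInterchange`, the gain data of `JmCusp (i)` and eventual IRREDUCIBILITY of the `(N_L, 0)` floor under a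
family of pair-field-twisting unitary symmetries give X, granted the torus every-from-some transfer `hEFS`
(stubs `stub_schurBridge` + `stub_everyFromSome_torus` of the same line). Pure logic.

Proof (pure logic, as `jmCruxGlue_proof`): destructure the gain-and-irreducibility data `(U, δ, a, J₀, L₁)`;
`JmInterchange` at `(U, δ, a, J₀)` gives `a' > 0`, `L₀` and, for even `L ≥ L₀`, SOME bridged unit ground-floor
pair; for even `L ≥ max L₀ L₁` the floor is irreducible under the symmetry family `S`, and `hEFS` transfers the
bound `a' L⁴` to EVERY unit ground state. The conclusion is the body of the crux `def JmPairBridge` verbatim, so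
the by-name form is just the term `stub_schurGlue hEFS hI hC : JmPairBridge` (checked locally: the `def` unfolds).

Sources: T. Koma, H. Tasaki, J. Stat. Phys. 76 (1994) 745, §3.4; J.-P. Serre, *Linear Representations of
Finite Groups* §2.2. No definition, no named fact.
-/

noncomputable section

-- the mandated namespace `Summit.<Summit>.<Problem>.Theorems` repeats `HubbardSuperconductivity`
-- (single-problem summit, D-0017), which the `dupNamespace` linter flags on every declaration
set_option linter.dupNamespace false

namespace Summit.HubbardSuperconductivity.HubbardSuperconductivity.Theorems.JosephsonMirror

open Matrix Literature.MathematicalPhysics.QuantumLattice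
open Summit.HubbardSuperconductivity.HubbardSuperconductivity.Theses.JosephsonMirror (JmInterchange)
open scoped ComplexOrder

/-- **STUB `stub_schurGlue`** (pure logic; the Schur form of the route's `JmCruxGlue`). Taking the torus
every-from-some transfer as hypothesis `hEFS`: `JmInterchange`, together with the data of `JmCusp (i)`
(uniform linear Josephson gain at some `(U, δ, a, J₀)`) AND eventual irreducibility of the `(N_L, 0)`
ground floor at the same `(U, δ)` under some family of pair-field-twisting unitary symmetries, gives the
crux `JmPairBridge`: `JmInterchange` turns the gain into SOME bridged unit ground-floor pair with
`a' L⁴`, and `hEFS` upgrades it to EVERY unit ground state with the same constant.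
Koma–Tasaki, J. Stat. Phys. 76 (1994) 745, §3.4; Serre §2.2. [folklore] -/
theorem stub_schurGlue
    (hEFS : ∀ (L : ℕ) [NeZero L] (U : ℝ) (N : ℕ) (t : ℝ)
      (S : Set (Matrix (Finset (Orb (FermionTorus 2 L))) (Finset (Orb (FermionTorus 2 L))) ℂ)),
      (∀ X ∈ S, Xᴴ * X = 1 ∧ X * hubbardTorus 2 L 1 U = hubbardTorus 2 L 1 U * X ∧
        (∀ v ∈ szSector (Λ := FermionTorus 2 L) N 0, X *ᵥ v ∈ szSector (Λ := FermionTorus 2 L) N 0) ∧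
        (∀ v ∈ szSector (Λ := FermionTorus 2 L) (N - 2) 0,
          X *ᵥ v ∈ szSector (Λ := FermionTorus 2 L) (N - 2) 0) ∧
        ∃ ω : ℂ, ‖ω‖ = 1 ∧ X * pairField dWaveFormFactor L = ω • (pairField dWaveFormFactor L * X)) →
      (∀ K' : Submodule ℂ (Fock (Orb (FermionTorus 2 L))),
        K' ≤ szSector (Λ := FermionTorus 2 L) N 0 ⊓
            Module.End.eigenspace (Matrix.toLin' (hubbardTorus 2 L 1 U))
              (((hubbardTorus 2 L 1 U).minEnergyOn (szSector (Λ := FermionTorus 2 L) N 0) : ℝ) : ℂ) →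
        (∀ X ∈ S, ∀ v ∈ K', X *ᵥ v ∈ K') →
        K' = ⊥ ∨ K' = szSector (Λ := FermionTorus 2 L) N 0 ⊓
            Module.End.eigenspace (Matrix.toLin' (hubbardTorus 2 L 1 U))
              (((hubbardTorus 2 L 1 U).minEnergyOn (szSector (Λ := FermionTorus 2 L) N 0) : ℝ) : ℂ)) →
      (∃ φ₀ χ₀ : Fock (Orb (FermionTorus 2 L)),
        IsGroundStateInSector (hubbardTorus 2 L 1 U) N 0 φ₀ ∧ star φ₀ ⬝ᵥ φ₀ = 1 ∧
        IsGroundStateInSector (hubbardTorus 2 L 1 U) (N - 2) 0 χ₀ ∧ star χ₀ ⬝ᵥ χ₀ = 1 ∧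
        t ≤ ‖star χ₀ ⬝ᵥ Matrix.mulVec (pairField dWaveFormFactor L) φ₀‖ ^ 2) →
      ∀ φ : Fock (Orb (FermionTorus 2 L)), IsGroundStateInSector (hubbardTorus 2 L 1 U) N 0 φ →
        star φ ⬝ᵥ φ = 1 →
        ∃ χ : Fock (Orb (FermionTorus 2 L)), IsGroundStateInSector (hubbardTorus 2 L 1 U) (N - 2) 0 χ ∧
          star χ ⬝ᵥ χ = 1 ∧ t ≤ ‖star χ ⬝ᵥ Matrix.mulVec (pairField dWaveFormFactor L) φ‖ ^ 2) :
    JmInterchange →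
    (∃ U : ℝ, 0 < U ∧ ∃ δ ∈ Set.Ioo (0:ℝ) (1 / 2), ∃ a : ℝ, 0 < a ∧ ∃ J₀ : ℝ, 0 < J₀ ∧
      (∀ J ∈ Set.Ioc (0:ℝ) J₀, ∃ L₀ : ℕ, ∀ (L : ℕ) [NeZero L], Even L → L₀ ≤ L →
        (let ι : Type := Finset (Orb (FermionTorus 2 L))
         let N : ℕ := 2 * ⌊(1 - δ) * (L : ℝ) ^ 2 / 2⌋₊
         let H : Matrix ι ι ℂ := hubbardTorus 2 L 1 U
         let μ : ℝ := (H.minEnergyOn (szSector N 0) - H.minEnergyOn (szSector (N - 2) 0)) / 2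
         let A : Matrix ι ι ℂ := hubbardTorusWith 2 L 1 U μ
         let D : Matrix ι ι ℂ := ((L : ℂ))⁻¹ • pairField dWaveFormFactor L
         let Hd : ℝ → Matrix (ι × ι) (ι × ι) ℂ := fun J =>
           Matrix.kroneckerMap (fun a b : ℂ => a * b) A 1 +
             Matrix.kroneckerMap (fun a b : ℂ => a * b) 1 (Matrix.transpose A) -
             (J : ℂ) • (Matrix.kroneckerMap (fun a b : ℂ => a * b) D
                 (Matrix.transpose (Matrix.conjTranspose D)) +
               Matrix.kroneckerMap (fun a b : ℂ => a * b) (Matrix.conjTranspose D) (Matrix.transpose D))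
         let good : ι × ι → Prop := fun p =>
           ((p.1.card = N ∧ p.2.card = N) ∨ (p.1.card = N - 2 ∧ p.2.card = N - 2)) ∧
             (p.1.filter (fun o => (ofLex o).2 = 0)).card = (p.1.filter (fun o => (ofLex o).2 = 1)).card ∧
             (p.2.filter (fun o => (ofLex o).2 = 0)).card = (p.2.filter (fun o => (ofLex o).2 = 1)).card
         let S : Submodule ℂ (ι × ι → ℂ) :=
           ⨅ (p : ι × ι) (_ : ¬ good p), LinearMap.ker (LinearMap.proj (R := ℂ) (φ := fun _ : ι × ι => ℂ) p)
         let E : ℝ → ℝ := fun J => (Hd J).minEnergyOn S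
         a * J * (L : ℝ) ^ 2 ≤ E 0 - E J)) ∧
      (∃ L₁ : ℕ, ∀ (L : ℕ) [NeZero L], Even L → L₁ ≤ L →
        ∃ S : Set (Matrix (Finset (Orb (FermionTorus 2 L))) (Finset (Orb (FermionTorus 2 L))) ℂ),
          (∀ X ∈ S, Xᴴ * X = 1 ∧ X * hubbardTorus 2 L 1 U = hubbardTorus 2 L 1 U * X ∧
            (∀ v ∈ szSector (Λ := FermionTorus 2 L) (2 * ⌊(1 - δ) * (L : ℝ) ^ 2 / 2⌋₊) 0,
              X *ᵥ v ∈ szSector (Λ := FermionTorus 2 L) (2 * ⌊(1 - δ) * (L : ℝ) ^ 2 / 2⌋₊) 0) ∧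
            (∀ v ∈ szSector (Λ := FermionTorus 2 L) (2 * ⌊(1 - δ) * (L : ℝ) ^ 2 / 2⌋₊ - 2) 0,
              X *ᵥ v ∈ szSector (Λ := FermionTorus 2 L) (2 * ⌊(1 - δ) * (L : ℝ) ^ 2 / 2⌋₊ - 2) 0) ∧
            ∃ ω : ℂ, ‖ω‖ = 1 ∧
              X * pairField dWaveFormFactor L = ω • (pairField dWaveFormFactor L * X)) ∧
          ∀ K' : Submodule ℂ (Fock (Orb (FermionTorus 2 L))),
            K' ≤ szSector (Λ := FermionTorus 2 L) (2 * ⌊(1 - δ) * (L : ℝ) ^ 2 / 2⌋₊) 0 ⊓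
                Module.End.eigenspace (Matrix.toLin' (hubbardTorus 2 L 1 U))
                  (((hubbardTorus 2 L 1 U).minEnergyOn
                    (szSector (Λ := FermionTorus 2 L) (2 * ⌊(1 - δ) * (L : ℝ) ^ 2 / 2⌋₊) 0) : ℝ) : ℂ) →
            (∀ X ∈ S, ∀ v ∈ K', X *ᵥ v ∈ K') →
            K' = ⊥ ∨ K' = szSector (Λ := FermionTorus 2 L) (2 * ⌊(1 - δ) * (L : ℝ) ^ 2 / 2⌋₊) 0 ⊓
                Module.End.eigenspace (Matrix.toLin' (hubbardTorus 2 L 1 U))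
                  (((hubbardTorus 2 L 1 U).minEnergyOn
                    (szSector (Λ := FermionTorus 2 L) (2 * ⌊(1 - δ) * (L : ℝ) ^ 2 / 2⌋₊) 0) : ℝ) : ℂ))) →
    ∃ U : ℝ, 0 < U ∧ ∃ δ ∈ Set.Ioo (0:ℝ) (1 / 2), ∃ a : ℝ, 0 < a ∧ ∃ L₀ : ℕ, ∀ (L : ℕ) [NeZero L],
      Even L → L₀ ≤ L → ∀ φ : Fock (Orb (FermionTorus 2 L)),
        IsGroundStateInSector (hubbardTorus 2 L 1 U) (2 * ⌊(1 - δ) * (L : ℝ) ^ 2 / 2⌋₊) 0 φ →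
        star φ ⬝ᵥ φ = 1 →
        ∃ χ : Fock (Orb (FermionTorus 2 L)),
          IsGroundStateInSector (hubbardTorus 2 L 1 U) (2 * ⌊(1 - δ) * (L : ℝ) ^ 2 / 2⌋₊ - 2) 0 χ ∧
          star χ ⬝ᵥ χ = 1 ∧
          a * (L : ℝ) ^ 4 ≤ ‖star χ ⬝ᵥ Matrix.mulVec (pairField dWaveFormFactor L) φ‖ ^ 2 := by
  intro hI hC
  obtain ⟨U, hU, δ, hδ, a, ha, J₀, hJ₀, hgain, L₁, hirrL⟩ := hC
  obtain ⟨a', ha', L₀, hbridge⟩ := hI U δ a J₀ hU hδ ha hJ₀ hgain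
  refine ⟨U, hU, δ, hδ, a', ha', max L₀ L₁, fun L _ hE hL φ hφ hφ1 => ?_⟩
  obtain ⟨φ₀, χ₀, hφ₀, hφ₀1, hχ₀, hχ₀1, hle⟩ := hbridge L hE (le_of_max_le_left hL)
  obtain ⟨S, hS, hirr⟩ := hirrL L hE (le_of_max_le_right hL)
  exact hEFS L U _ _ S hS hirr ⟨φ₀, χ₀, hφ₀, hφ₀1, hχ₀, hχ₀1, hle⟩ φ hφ hφ1

/-- **`jmPairBridge_of_interchange`** — the Schur form of the route glue, concluding the crux BY NAME:
`JmInterchange`, the gain data of `JmCusp (i)` and eventual irreducibility of the `(N_L, 0)` ground floor give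
`JmPairBridge`, granted the torus every-from-some transfer `hEFS`. Koma–Tasaki, J. Stat. Phys. 76 (1994) 745,
§3.4; Serre §2.2. [folklore] -/
theorem jmPairBridge_of_interchange
    (hEFS : ∀ (L : ℕ) [NeZero L] (U : ℝ) (N : ℕ) (t : ℝ)
      (S : Set (Matrix (Finset (Orb (FermionTorus 2 L))) (Finset (Orb (FermionTorus 2 L))) ℂ)),
      (∀ X ∈ S, Xᴴ * X = 1 ∧ X * hubbardTorus 2 L 1 U = hubbardTorus 2 L 1 U * X ∧
        (∀ v ∈ szSector (Λ := FermionTorus 2 L) N 0, X *ᵥ v ∈ szSector (Λ := FermionTorus 2 L) N 0) ∧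
        (∀ v ∈ szSector (Λ := FermionTorus 2 L) (N - 2) 0,
          X *ᵥ v ∈ szSector (Λ := FermionTorus 2 L) (N - 2) 0) ∧
        ∃ ω : ℂ, ‖ω‖ = 1 ∧ X * pairField dWaveFormFactor L = ω • (pairField dWaveFormFactor L * X)) →
      (∀ K' : Submodule ℂ (Fock (Orb (FermionTorus 2 L))),
        K' ≤ szSector (Λ := FermionTorus 2 L) N 0 ⊓
            Module.End.eigenspace (Matrix.toLin' (hubbardTorus 2 L 1 U))
              (((hubbardTorus 2 L 1 U).minEnergyOn (szSector (Λ := FermionTorus 2 L) N 0) : ℝ) : ℂ) →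
        (∀ X ∈ S, ∀ v ∈ K', X *ᵥ v ∈ K') →
        K' = ⊥ ∨ K' = szSector (Λ := FermionTorus 2 L) N 0 ⊓
            Module.End.eigenspace (Matrix.toLin' (hubbardTorus 2 L 1 U))
              (((hubbardTorus 2 L 1 U).minEnergyOn (szSector (Λ := FermionTorus 2 L) N 0) : ℝ) : ℂ)) →
      (∃ φ₀ χ₀ : Fock (Orb (FermionTorus 2 L)),
        IsGroundStateInSector (hubbardTorus 2 L 1 U) N 0 φ₀ ∧ star φ₀ ⬝ᵥ φ₀ = 1 ∧
        IsGroundStateInSector (hubbardTorus 2 L 1 U) (N - 2) 0 χ₀ ∧ star χ₀ ⬝ᵥ χ₀ = 1 ∧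
        t ≤ ‖star χ₀ ⬝ᵥ Matrix.mulVec (pairField dWaveFormFactor L) φ₀‖ ^ 2) →
      ∀ φ : Fock (Orb (FermionTorus 2 L)), IsGroundStateInSector (hubbardTorus 2 L 1 U) N 0 φ →
        star φ ⬝ᵥ φ = 1 →
        ∃ χ : Fock (Orb (FermionTorus 2 L)), IsGroundStateInSector (hubbardTorus 2 L 1 U) (N - 2) 0 χ ∧
          star χ ⬝ᵥ χ = 1 ∧ t ≤ ‖star χ ⬝ᵥ Matrix.mulVec (pairField dWaveFormFactor L) φ‖ ^ 2)
    (hI : JmInterchange)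
    (hC : ∃ U : ℝ, 0 < U ∧ ∃ δ ∈ Set.Ioo (0:ℝ) (1 / 2), ∃ a : ℝ, 0 < a ∧ ∃ J₀ : ℝ, 0 < J₀ ∧
      (∀ J ∈ Set.Ioc (0:ℝ) J₀, ∃ L₀ : ℕ, ∀ (L : ℕ) [NeZero L], Even L → L₀ ≤ L →
        (let ι : Type := Finset (Orb (FermionTorus 2 L))
         let N : ℕ := 2 * ⌊(1 - δ) * (L : ℝ) ^ 2 / 2⌋₊
         let H : Matrix ι ι ℂ := hubbardTorus 2 L 1 U
         let μ : ℝ := (H.minEnergyOn (szSector N 0) - H.minEnergyOn (szSector (N - 2) 0)) / 2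
         let A : Matrix ι ι ℂ := hubbardTorusWith 2 L 1 U μ
         let D : Matrix ι ι ℂ := ((L : ℂ))⁻¹ • pairField dWaveFormFactor L
         let Hd : ℝ → Matrix (ι × ι) (ι × ι) ℂ := fun J =>
           Matrix.kroneckerMap (fun a b : ℂ => a * b) A 1 +
             Matrix.kroneckerMap (fun a b : ℂ => a * b) 1 (Matrix.transpose A) -
             (J : ℂ) • (Matrix.kroneckerMap (fun a b : ℂ => a * b) D
                 (Matrix.transpose (Matrix.conjTranspose D)) +
               Matrix.kroneckerMap (fun a b : ℂ => a * b) (Matrix.conjTranspose D) (Matrix.transpose D))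
         let good : ι × ι → Prop := fun p =>
           ((p.1.card = N ∧ p.2.card = N) ∨ (p.1.card = N - 2 ∧ p.2.card = N - 2)) ∧
             (p.1.filter (fun o => (ofLex o).2 = 0)).card = (p.1.filter (fun o => (ofLex o).2 = 1)).card ∧
             (p.2.filter (fun o => (ofLex o).2 = 0)).card = (p.2.filter (fun o => (ofLex o).2 = 1)).card
         let S : Submodule ℂ (ι × ι → ℂ) :=
           ⨅ (p : ι × ι) (_ : ¬ good p), LinearMap.ker (LinearMap.proj (R := ℂ) (φ := fun _ : ι × ι => ℂ) p)
         let E : ℝ → ℝ := fun J => (Hd J).minEnergyOn S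
         a * J * (L : ℝ) ^ 2 ≤ E 0 - E J)) ∧
      (∃ L₁ : ℕ, ∀ (L : ℕ) [NeZero L], Even L → L₁ ≤ L →
        ∃ S : Set (Matrix (Finset (Orb (FermionTorus 2 L))) (Finset (Orb (FermionTorus 2 L))) ℂ),
          (∀ X ∈ S, Xᴴ * X = 1 ∧ X * hubbardTorus 2 L 1 U = hubbardTorus 2 L 1 U * X ∧
            (∀ v ∈ szSector (Λ := FermionTorus 2 L) (2 * ⌊(1 - δ) * (L : ℝ) ^ 2 / 2⌋₊) 0,
              X *ᵥ v ∈ szSector (Λ := FermionTorus 2 L) (2 * ⌊(1 - δ) * (L : ℝ) ^ 2 / 2⌋₊) 0) ∧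
            (∀ v ∈ szSector (Λ := FermionTorus 2 L) (2 * ⌊(1 - δ) * (L : ℝ) ^ 2 / 2⌋₊ - 2) 0,
              X *ᵥ v ∈ szSector (Λ := FermionTorus 2 L) (2 * ⌊(1 - δ) * (L : ℝ) ^ 2 / 2⌋₊ - 2) 0) ∧
            ∃ ω : ℂ, ‖ω‖ = 1 ∧
              X * pairField dWaveFormFactor L = ω • (pairField dWaveFormFactor L * X)) ∧
          ∀ K' : Submodule ℂ (Fock (Orb (FermionTorus 2 L))),
            K' ≤ szSector (Λ := FermionTorus 2 L) (2 * ⌊(1 - δ) * (L : ℝ) ^ 2 / 2⌋₊) 0 ⊓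
                Module.End.eigenspace (Matrix.toLin' (hubbardTorus 2 L 1 U))
                  (((hubbardTorus 2 L 1 U).minEnergyOn
                    (szSector (Λ := FermionTorus 2 L) (2 * ⌊(1 - δ) * (L : ℝ) ^ 2 / 2⌋₊) 0) : ℝ) : ℂ) →
            (∀ X ∈ S, ∀ v ∈ K', X *ᵥ v ∈ K') →
            K' = ⊥ ∨ K' = szSector (Λ := FermionTorus 2 L) (2 * ⌊(1 - δ) * (L : ℝ) ^ 2 / 2⌋₊) 0 ⊓
                Module.End.eigenspace (Matrix.toLin' (hubbardTorus 2 L 1 U))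
                  (((hubbardTorus 2 L 1 U).minEnergyOn
                    (szSector (Λ := FermionTorus 2 L) (2 * ⌊(1 - δ) * (L : ℝ) ^ 2 / 2⌋₊) 0) : ℝ) : ℂ))) :
    Summit.HubbardSuperconductivity.HubbardSuperconductivity.Theses.JosephsonMirror.JmPairBridge :=
  stub_schurGlue hEFS hI hC

end Summit.HubbardSuperconductivity.HubbardSuperconductivity.Theorems.JosephsonMirror

end
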